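import Summits.QuantumFields.BalabanUV.T4Continuum.Support.NE7K1LinConjW

/-!
# NE7K1LinBilinConjError — row NE7 (node U5), candidate route HOM, path H1L, cell K1-lin(s): (π6)(ii), abstract part — the BILINEAR
# conjugation error of a weighted graph Laplacian and of a block term, bounded FORM-RELATIVELY

Lineage `b2b-balaban-t4-ne7-p2` (CRUX PROVER NE7 #2), generation 64; input of `NE7K1LinFineOpBilinWeight` (the `A = 0` operator)
and, through it, of `NE7K1LinSchurLineDerivRelW.inv_line_sub_inv_line_weighted`'s hypothesis `hb₀`.  The QUADRATIC error
(`Beta.CombesThomasForm.conjError_lap_ge`) kills the first order by symmetry; the BILINEAR one keeps an antisymmetric `sinh` part,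
which is small only RELATIVE TO THE DIRICHLET FORM.  [folklore], real matrices:
* `cs_double` ∕ `abs_double_le_sqrt` (Cauchy–Schwarz for double sums); `sinh_sq_le` (`sinh² t ≤ 4(cosh t − 1)` for `|t| ≤ 1`);
  `sum_c_sq_sub_eq` (`Σ c (v_k − v_j)² = 2⟨v, lap c v⟩`); `bilin_conjW_sub_eq` (the bilinear error as a double sum);
* **`bilin_conjError_lap_le`**: `c` symmetric `≥ 0`, row defect `Σ_k c_{jk}(cosh(φ_j−φ_k) − 1) ≤ κ`, bond oscillation `≤ 1` ⇒
  `|⟨z,(conjW φ (lap c))u⟩ − ⟨z,(lap c)u⟩| ≤ √(2κ)(‖z‖√D(u) + ‖u‖√D(z)) + κ‖z‖‖u‖`, `D(v) = ⟨v, lap c v⟩`, `‖v‖ = √(v⬝v)`;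
* **`bilin_conjError_blocks_le`**: `B_{jk} = m_{blk j}[blk j = blk k]`, `m_b|b| ≤ a`, block oscillation `≤ Θ` ⇒
  `|Σ(e^{φ_j−φ_k}−1)B_{jk}z_ju_k| ≤ a(e^Θ − 1)‖z‖‖u‖`.

HONEST FRAMING: [folklore]; nothing printed asserted; no `sorry`.  FIXED FINITE T⁴, rung (B)+1; NE7 NOT PRINTED ∕ NOT PROVED; spine
0∕9; NOT infinite volume, NOT mass gap, NOT Clay.  HONEST DEPENDENCY: continuum YM on T⁴ ⇐ BetaPertH ∧ nine spine estimates (0/9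
proved); BetaPertH ⇐ (D1) ∧ (D4) ∧ CAP+tail; G-an2-4 gates asym, D1 and NE2/3/4.
-/

noncomputable section

open Finset Matrix

namespace Summit.QuantumFields.BalabanUV.T4Continuum.NE7K1LinBilinConjError

open Literature.MathematicalPhysics.QuantumFieldTheory.Balaban1983to89.Beta.CombesThomasForm (lap lap_apply lap_form lapDefect_le
  abs_exp_sub_one_le)
open NE7K1LinConjW

/-! ### §1 Abstract: bilinear conjugation error of a weighted graph Laplacian and of a block term -/

section Abstract

variable {ι : Type*} [Fintype ι]

/-- Cauchy–Schwarz for double sums: `(Σ_{jk} a_{jk}b_{jk})² ≤ (Σ a²)(Σ b²)`. [folklore] -/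
theorem cs_double (a b : ι → ι → ℝ) :
    (∑ j, ∑ k, a j k * b j k) ^ 2 ≤ (∑ j, ∑ k, a j k ^ 2) * (∑ j, ∑ k, b j k ^ 2) := by
  have h := Finset.sum_mul_sq_le_sq_mul_sq (Finset.univ : Finset (ι × ι)) (fun p => a p.1 p.2) (fun p => b p.1 p.2)
  simpa only [Fintype.sum_prod_type] using h

/-- `|Σ_{jk} a b| ≤ √(Σ a²)·√(Σ b²)`. [folklore] -/
theorem abs_double_le_sqrt (a b : ι → ι → ℝ) :
    |∑ j, ∑ k, a j k * b j k| ≤ Real.sqrt (∑ j, ∑ k, a j k ^ 2) * Real.sqrt (∑ j, ∑ k, b j k ^ 2) := by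
  have hA : 0 ≤ ∑ j, ∑ k, a j k ^ 2 := Finset.sum_nonneg fun _ _ => Finset.sum_nonneg fun _ _ => sq_nonneg _
  rw [← Real.sqrt_mul hA, ← Real.sqrt_sq_eq_abs]
  exact Real.sqrt_le_sqrt (cs_double a b)

/-- `sinh² t ≤ 4(cosh t − 1)` for `|t| ≤ 1` (`sinh² = (cosh − 1)(cosh + 1)`, `cosh t ≤ e < 3`). [folklore] -/
theorem sinh_sq_le {t : ℝ} (ht : |t| ≤ 1) : Real.sinh t ^ 2 ≤ 4 * (Real.cosh t - 1) := by
  have h1 : Real.sinh t ^ 2 = (Real.cosh t - 1) * (Real.cosh t + 1) := by nlinarith [Real.cosh_sq t]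
  have hcosh : Real.cosh t ≤ 3 := by
    rw [Real.cosh_eq]
    have ha := abs_le.1 ht
    have e1 : Real.exp t ≤ Real.exp 1 := Real.exp_le_exp.2 ha.2
    have e2 : Real.exp (-t) ≤ Real.exp 1 := Real.exp_le_exp.2 (by linarith)
    have e3 : Real.exp 1 < 3 := lt_trans Real.exp_one_lt_d9 (by norm_num)
    linarith
  have h0 : 0 ≤ Real.cosh t - 1 := by linarith [Real.one_le_cosh t]
  rw [h1]
  nlinarith

variable [DecidableEq ι]

/-- the Dirichlet form of `lap c`: `Σ_{jk} c_{jk}(v_k − v_j)² = 2⟨v, lap c v⟩` (symmetric `c`). [folklore] -/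
theorem sum_c_sq_sub_eq (c : ι → ι → ℝ) (hc : ∀ j k, c j k = c k j) (v : ι → ℝ) :
    ∑ j, ∑ k, c j k * (v k - v j) ^ 2 = 2 * (v ⬝ᵥ (lap c).mulVec v) := by
  rw [lap_form c hc v]
  have : ∑ j, ∑ k, c j k * (v k - v j) ^ 2 = ∑ j, ∑ k, c j k * (v j - v k) ^ 2 :=
    Finset.sum_congr rfl fun j _ => Finset.sum_congr rfl fun k _ => by ring
  rw [this]; ring

/-- **BILINEAR CONJUGATION ERROR OF A WEIGHTED GRAPH LAPLACIAN, FORM-RELATIVE.**  `c` symmetric `≥ 0`, row defect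
`Σ_k c_{jk}(cosh(φ_j−φ_k) − 1) ≤ κ` (`κ ≥ 0`), bond oscillation `|φ_j − φ_k| ≤ 1` where `c_{jk} ≠ 0`.  Then for all `z, u`:
`|⟨z,(conjW φ (lap c))u⟩ − ⟨z,(lap c)u⟩| ≤ √(2κ)·(√(z⬝z)·√(2⟨u,lap c u⟩∕2)…)` — precisely
`≤ Real.sqrt (4κ)·(√(z⬝z)·√(2D(u)) + √(u⬝u)·√(2D(z)))∕2 + κ·√(z⬝z)·√(u⬝u)`, `D(v) = ⟨v, lap c v⟩`. [folklore] -/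
theorem bilin_conjError_lap_le (c : ι → ι → ℝ) (hc : ∀ j k, c j k = c k j) (hc0 : ∀ j k, 0 ≤ c j k) (φ : ι → ℝ)
    {κ : ℝ} (hκ0 : 0 ≤ κ) (hκ : ∀ j, ∑ k, c j k * (Real.cosh (φ j - φ k) - 1) ≤ κ)
    (hsmall : ∀ j k, c j k ≠ 0 → |φ j - φ k| ≤ 1) (z u : ι → ℝ) :
    |z ⬝ᵥ (conjW φ (lap c)).mulVec u - z ⬝ᵥ (lap c).mulVec u| ≤
      Real.sqrt (2 * κ) * (Real.sqrt (z ⬝ᵥ z) * Real.sqrt (u ⬝ᵥ (lap c).mulVec u) +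
          Real.sqrt (u ⬝ᵥ u) * Real.sqrt (z ⬝ᵥ (lap c).mulVec z)) +
        κ * (Real.sqrt (z ⬝ᵥ z) * Real.sqrt (u ⬝ᵥ u)) := by
  -- Step 0: the error as a double sum; the diagonal of `lap` drops out
  have herr : z ⬝ᵥ (conjW φ (lap c)).mulVec u - z ⬝ᵥ (lap c).mulVec u =
      -∑ j, ∑ k, (Real.exp (φ j - φ k) - 1) * c j k * (z j * u k) := by
    simp only [dotProduct, mulVec, conjW_apply, Finset.mul_sum, ← Finset.sum_sub_distrib, ← Finset.sum_neg_distrib]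
    refine Finset.sum_congr rfl fun j _ => Finset.sum_congr rfl fun k _ => ?_
    by_cases hjk : j = k
    · subst hjk; simp
    · rw [lap_apply, if_neg hjk, zero_sub]; ring
  -- Step 1: split `e^t − 1 = sinh t + (cosh t − 1)`
  have hsplit : ∀ j k, Real.exp (φ j - φ k) - 1 = Real.sinh (φ j - φ k) + (Real.cosh (φ j - φ k) - 1) := by
    intro j k; rw [Real.sinh_eq, Real.cosh_eq]; ring
  set Ta := ∑ j, ∑ k, Real.sinh (φ j - φ k) * c j k * (z j * u k) with hTa
  set Tq := ∑ j, ∑ k, (Real.cosh (φ j - φ k) - 1) * c j k * (z j * u k) with hTq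
  have hsum : ∑ j, ∑ k, (Real.exp (φ j - φ k) - 1) * c j k * (z j * u k) = Ta + Tq := by
    rw [hTa, hTq, ← Finset.sum_add_distrib]
    refine Finset.sum_congr rfl fun j _ => ?_
    rw [← Finset.sum_add_distrib]
    exact Finset.sum_congr rfl fun k _ => by rw [hsplit]; ring
  -- Step 2: the antisymmetric part, symmetrised: `Ta = ½ Σ sinh·c·(z_j(u_k − u_j) + u_j(z_j − z_k))`
  have hanti : ∀ j k, Real.sinh (φ k - φ j) * c k j = -(Real.sinh (φ j - φ k) * c j k) := by
    intro j k; rw [hc k j, show φ k - φ j = -(φ j - φ k) by ring, Real.sinh_neg]; ring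
  have hTa2 : 2 * Ta = ∑ j, ∑ k, Real.sinh (φ j - φ k) * c j k * (z j * (u k - u j)) +
      ∑ j, ∑ k, Real.sinh (φ j - φ k) * c j k * (u j * (z j - z k)) := by
    have hswap : Ta = ∑ j, ∑ k, Real.sinh (φ k - φ j) * c k j * (z k * u j) := by
      rw [hTa, Finset.sum_comm]
    have hneg : Ta = -∑ j, ∑ k, Real.sinh (φ j - φ k) * c j k * (z k * u j) := by
      rw [hswap, ← Finset.sum_neg_distrib]
      refine Finset.sum_congr rfl fun j _ => ?_
      rw [← Finset.sum_neg_distrib]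
      exact Finset.sum_congr rfl fun k _ => by rw [hanti]; ring
    have e1 : 2 * Ta = (∑ j, ∑ k, Real.sinh (φ j - φ k) * c j k * (z j * u k)) +
        -∑ j, ∑ k, Real.sinh (φ j - φ k) * c j k * (z k * u j) := by
      rw [two_mul]
      nth_rewrite 1 [hTa]
      rw [← hneg]
    rw [e1, ← sub_eq_add_neg, ← Finset.sum_sub_distrib, ← Finset.sum_add_distrib]
    refine Finset.sum_congr rfl fun j _ => ?_
    rw [← Finset.sum_sub_distrib, ← Finset.sum_add_distrib]
    exact Finset.sum_congr rfl fun k _ => by ring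
  -- Step 3: Cauchy–Schwarz on each symmetrised piece
  have hrow : ∀ v : ι → ℝ, ∑ j, ∑ k, (Real.sinh (φ j - φ k) * Real.sqrt (c j k) * v j) ^ 2 ≤ 4 * κ * (v ⬝ᵥ v) := by
    intro v
    have hterm : ∀ j, ∑ k, (Real.sinh (φ j - φ k) * Real.sqrt (c j k) * v j) ^ 2 ≤ 4 * κ * (v j * v j) := by
      intro j
      have h1 : ∑ k, (Real.sinh (φ j - φ k) * Real.sqrt (c j k) * v j) ^ 2 =
          (∑ k, c j k * Real.sinh (φ j - φ k) ^ 2) * (v j * v j) := by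
        rw [Finset.sum_mul]
        refine Finset.sum_congr rfl fun k _ => ?_
        rw [mul_pow, mul_pow, Real.sq_sqrt (hc0 j k)]; ring
      have h2 : ∑ k, c j k * Real.sinh (φ j - φ k) ^ 2 ≤ 4 * κ := by
        calc ∑ k, c j k * Real.sinh (φ j - φ k) ^ 2 ≤ ∑ k, c j k * (4 * (Real.cosh (φ j - φ k) - 1)) := by
              refine Finset.sum_le_sum fun k _ => ?_
              by_cases hjk : c j k = 0
              · rw [hjk, zero_mul, zero_mul]
              · exact mul_le_mul_of_nonneg_left (sinh_sq_le (hsmall j k hjk)) (hc0 j k)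
          _ = 4 * ∑ k, c j k * (Real.cosh (φ j - φ k) - 1) := by rw [Finset.mul_sum]; exact Finset.sum_congr rfl fun k _ => by ring
          _ ≤ 4 * κ := by linarith [hκ j]
      rw [h1]
      exact mul_le_mul_of_nonneg_right h2 (mul_self_nonneg _)
    calc ∑ j, ∑ k, (Real.sinh (φ j - φ k) * Real.sqrt (c j k) * v j) ^ 2 ≤ ∑ j, 4 * κ * (v j * v j) :=
          Finset.sum_le_sum fun j _ => hterm j
      _ = 4 * κ * (v ⬝ᵥ v) := by rw [← Finset.mul_sum]; rfl
  have hdir : ∀ v : ι → ℝ, ∑ j, ∑ k, (Real.sqrt (c j k) * (v k - v j)) ^ 2 = 2 * (v ⬝ᵥ (lap c).mulVec v) := by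
    intro v
    rw [← sum_c_sq_sub_eq c hc v]
    exact Finset.sum_congr rfl fun j _ => Finset.sum_congr rfl fun k _ => by rw [mul_pow, Real.sq_sqrt (hc0 j k)]
  have hA1 : |∑ j, ∑ k, Real.sinh (φ j - φ k) * c j k * (z j * (u k - u j))| ≤
      Real.sqrt (4 * κ * (z ⬝ᵥ z)) * Real.sqrt (2 * (u ⬝ᵥ (lap c).mulVec u)) := by
    have h := abs_double_le_sqrt (fun j k => Real.sinh (φ j - φ k) * Real.sqrt (c j k) * z j)
      (fun j k => Real.sqrt (c j k) * (u k - u j))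
    have heq : ∑ j, ∑ k, Real.sinh (φ j - φ k) * Real.sqrt (c j k) * z j * (Real.sqrt (c j k) * (u k - u j)) =
        ∑ j, ∑ k, Real.sinh (φ j - φ k) * c j k * (z j * (u k - u j)) := by
      refine Finset.sum_congr rfl fun j _ => Finset.sum_congr rfl fun k _ => ?_
      have := Real.mul_self_sqrt (hc0 j k)
      calc Real.sinh (φ j - φ k) * Real.sqrt (c j k) * z j * (Real.sqrt (c j k) * (u k - u j))
          = Real.sinh (φ j - φ k) * (Real.sqrt (c j k) * Real.sqrt (c j k)) * (z j * (u k - u j)) := by ring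
        _ = _ := by rw [this]
    rw [heq] at h
    refine h.trans ?_
    rw [hdir u]
    exact mul_le_mul_of_nonneg_right (Real.sqrt_le_sqrt (hrow z)) (Real.sqrt_nonneg _)
  have hA2 : |∑ j, ∑ k, Real.sinh (φ j - φ k) * c j k * (u j * (z j - z k))| ≤
      Real.sqrt (4 * κ * (u ⬝ᵥ u)) * Real.sqrt (2 * (z ⬝ᵥ (lap c).mulVec z)) := by
    have h := abs_double_le_sqrt (fun j k => Real.sinh (φ j - φ k) * Real.sqrt (c j k) * u j)
      (fun j k => Real.sqrt (c j k) * (z j - z k))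
    have heq : ∑ j, ∑ k, Real.sinh (φ j - φ k) * Real.sqrt (c j k) * u j * (Real.sqrt (c j k) * (z j - z k)) =
        ∑ j, ∑ k, Real.sinh (φ j - φ k) * c j k * (u j * (z j - z k)) := by
      refine Finset.sum_congr rfl fun j _ => Finset.sum_congr rfl fun k _ => ?_
      have := Real.mul_self_sqrt (hc0 j k)
      calc Real.sinh (φ j - φ k) * Real.sqrt (c j k) * u j * (Real.sqrt (c j k) * (z j - z k))
          = Real.sinh (φ j - φ k) * (Real.sqrt (c j k) * Real.sqrt (c j k)) * (u j * (z j - z k)) := by ring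
        _ = _ := by rw [this]
    rw [heq] at h
    refine h.trans ?_
    have hdir' : ∑ j, ∑ k, (Real.sqrt (c j k) * (z j - z k)) ^ 2 = 2 * (z ⬝ᵥ (lap c).mulVec z) := by
      rw [← hdir z]
      exact Finset.sum_congr rfl fun j _ => Finset.sum_congr rfl fun k _ => by ring
    rw [hdir']
    exact mul_le_mul_of_nonneg_right (Real.sqrt_le_sqrt (hrow u)) (Real.sqrt_nonneg _)
  -- Step 4: the symmetric part by Cauchy–Schwarz with the row defect
  have hq0 : ∀ j k, 0 ≤ (Real.cosh (φ j - φ k) - 1) * c j k := fun j k =>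
    mul_nonneg (by linarith [Real.one_le_cosh (φ j - φ k)]) (hc0 j k)
  have hqsym : ∀ j k, (Real.cosh (φ j - φ k) - 1) * c j k = (Real.cosh (φ k - φ j) - 1) * c k j := by
    intro j k; rw [hc j k, show φ k - φ j = -(φ j - φ k) by ring, Real.cosh_neg]
  have hQ : |Tq| ≤ κ * (Real.sqrt (z ⬝ᵥ z) * Real.sqrt (u ⬝ᵥ u)) := by
    have h := abs_double_le_sqrt (fun j k => Real.sqrt ((Real.cosh (φ j - φ k) - 1) * c j k) * z j)
      (fun j k => Real.sqrt ((Real.cosh (φ j - φ k) - 1) * c j k) * u k)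
    have heq : ∑ j, ∑ k, Real.sqrt ((Real.cosh (φ j - φ k) - 1) * c j k) * z j *
        (Real.sqrt ((Real.cosh (φ j - φ k) - 1) * c j k) * u k) = Tq := by
      rw [hTq]
      refine Finset.sum_congr rfl fun j _ => Finset.sum_congr rfl fun k _ => ?_
      have := Real.mul_self_sqrt (hq0 j k)
      calc Real.sqrt ((Real.cosh (φ j - φ k) - 1) * c j k) * z j * (Real.sqrt ((Real.cosh (φ j - φ k) - 1) * c j k) * u k)
          = (Real.sqrt ((Real.cosh (φ j - φ k) - 1) * c j k) * Real.sqrt ((Real.cosh (φ j - φ k) - 1) * c j k)) *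
              (z j * u k) := by ring
        _ = _ := by rw [this]
    rw [heq] at h
    have hz : ∑ j, ∑ k, (Real.sqrt ((Real.cosh (φ j - φ k) - 1) * c j k) * z j) ^ 2 ≤ κ * (z ⬝ᵥ z) := by
      have : ∑ j, ∑ k, (Real.sqrt ((Real.cosh (φ j - φ k) - 1) * c j k) * z j) ^ 2 =
          ∑ j, (∑ k, c j k * (Real.cosh (φ j - φ k) - 1)) * (z j * z j) := by
        refine Finset.sum_congr rfl fun j _ => ?_
        rw [Finset.sum_mul]
        refine Finset.sum_congr rfl fun k _ => ?_
        rw [mul_pow, Real.sq_sqrt (hq0 j k)]; ring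
      rw [this, dotProduct, Finset.mul_sum]
      exact Finset.sum_le_sum fun j _ => mul_le_mul_of_nonneg_right (hκ j) (mul_self_nonneg _)
    have hu : ∑ j, ∑ k, (Real.sqrt ((Real.cosh (φ j - φ k) - 1) * c j k) * u k) ^ 2 ≤ κ * (u ⬝ᵥ u) := by
      have : ∑ j, ∑ k, (Real.sqrt ((Real.cosh (φ j - φ k) - 1) * c j k) * u k) ^ 2 =
          ∑ k, (∑ j, c k j * (Real.cosh (φ k - φ j) - 1)) * (u k * u k) := by
        rw [Finset.sum_comm]
        refine Finset.sum_congr rfl fun k _ => ?_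
        rw [Finset.sum_mul]
        refine Finset.sum_congr rfl fun j _ => ?_
        rw [mul_pow, Real.sq_sqrt (hq0 j k), hqsym j k]; ring
      rw [this, dotProduct, Finset.mul_sum]
      exact Finset.sum_le_sum fun k _ => mul_le_mul_of_nonneg_right (hκ k) (mul_self_nonneg _)
    calc |Tq| ≤ Real.sqrt (κ * (z ⬝ᵥ z)) * Real.sqrt (κ * (u ⬝ᵥ u)) :=
          h.trans (mul_le_mul (Real.sqrt_le_sqrt hz) (Real.sqrt_le_sqrt hu) (Real.sqrt_nonneg _) (Real.sqrt_nonneg _))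
      _ = κ * (Real.sqrt (z ⬝ᵥ z) * Real.sqrt (u ⬝ᵥ u)) := by
          rw [Real.sqrt_mul hκ0, Real.sqrt_mul hκ0,
            show Real.sqrt κ * Real.sqrt (z ⬝ᵥ z) * (Real.sqrt κ * Real.sqrt (u ⬝ᵥ u)) =
              (Real.sqrt κ * Real.sqrt κ) * (Real.sqrt (z ⬝ᵥ z) * Real.sqrt (u ⬝ᵥ u)) by ring, Real.mul_self_sqrt hκ0]
  -- Step 5: assemble (`√(4κ·X)·√(2·Y) = 2·√(2κ)·√X·√Y`)
  have hzz : 0 ≤ z ⬝ᵥ z := by simp only [dotProduct]; exact Finset.sum_nonneg fun _ _ => mul_self_nonneg _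
  have huu : 0 ≤ u ⬝ᵥ u := by simp only [dotProduct]; exact Finset.sum_nonneg fun _ _ => mul_self_nonneg _
  have hDu : 0 ≤ u ⬝ᵥ (lap c).mulVec u := by
    have := hdir u; nlinarith [Finset.sum_nonneg fun j (_ : j ∈ Finset.univ) =>
      Finset.sum_nonneg fun k (_ : k ∈ Finset.univ) => sq_nonneg (Real.sqrt (c j k) * (u k - u j))]
  have hDz : 0 ≤ z ⬝ᵥ (lap c).mulVec z := by
    have := hdir z; nlinarith [Finset.sum_nonneg fun j (_ : j ∈ Finset.univ) =>
      Finset.sum_nonneg fun k (_ : k ∈ Finset.univ) => sq_nonneg (Real.sqrt (c j k) * (z k - z j))]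
  have hprod : ∀ X Y : ℝ, 0 ≤ X → 0 ≤ Y →
      Real.sqrt (4 * κ * X) * Real.sqrt (2 * Y) = 2 * (Real.sqrt (2 * κ) * (Real.sqrt X * Real.sqrt Y)) := by
    intro X Y hX hY
    have h4 : Real.sqrt 4 = 2 := by
      rw [show (4 : ℝ) = 2 ^ 2 by norm_num, Real.sqrt_sq (by norm_num : (0 : ℝ) ≤ 2)]
    rw [show 4 * κ * X = 4 * (κ * X) by ring, Real.sqrt_mul (by norm_num : (0 : ℝ) ≤ 4), h4,
      Real.sqrt_mul hκ0, Real.sqrt_mul (by norm_num : (0 : ℝ) ≤ 2), Real.sqrt_mul (by norm_num : (0 : ℝ) ≤ 2)]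
    ring
  have hTa_le : |Ta| ≤ Real.sqrt (2 * κ) * (Real.sqrt (z ⬝ᵥ z) * Real.sqrt (u ⬝ᵥ (lap c).mulVec u) +
      Real.sqrt (u ⬝ᵥ u) * Real.sqrt (z ⬝ᵥ (lap c).mulVec z)) := by
    have h2 : |2 * Ta| ≤ Real.sqrt (4 * κ * (z ⬝ᵥ z)) * Real.sqrt (2 * (u ⬝ᵥ (lap c).mulVec u)) +
        Real.sqrt (4 * κ * (u ⬝ᵥ u)) * Real.sqrt (2 * (z ⬝ᵥ (lap c).mulVec z)) := by
      rw [hTa2]; exact (abs_add_le _ _).trans (add_le_add hA1 hA2)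
    rw [hprod _ _ hzz hDu, hprod _ _ huu hDz, abs_mul, abs_two] at h2
    linarith
  rw [herr, hsum, abs_neg]
  exact (abs_add_le Ta Tq).trans (add_le_add hTa_le hQ)

omit [DecidableEq ι] in
/-- the bilinear conjugation error of any matrix as the weighted double sum. [folklore] -/
theorem bilin_conjW_sub_eq (φ : ι → ℝ) (M : Matrix ι ι ℝ) (z u : ι → ℝ) :
    z ⬝ᵥ (conjW φ M).mulVec u - z ⬝ᵥ M.mulVec u = ∑ j, ∑ k, (Real.exp (φ j - φ k) - 1) * M j k * (z j * u k) := by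
  simp only [dotProduct, mulVec, conjW_apply, Finset.mul_sum, ← Finset.sum_sub_distrib]
  exact Finset.sum_congr rfl fun j _ => Finset.sum_congr rfl fun k _ => by ring

omit [DecidableEq ι] in
/-- **BILINEAR CONJUGATION ERROR OF A BLOCK TERM** `B_{jk} = m_{blk j}·[blk j = blk k]` (`0 ≤ m`, row mass `m_b|b| ≤ a`, block
oscillation `≤ Θ`, `Θ ≥ 0`): `|Σ_{jk}(e^{φ_j−φ_k}−1)B_{jk}z_ju_k| ≤ a(e^Θ − 1)·√(z⬝z)·√(u⬝u)`. [folklore] -/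
theorem bilin_conjError_blocks_le {β : Type*} [DecidableEq β] (blk : ι → β) (m : β → ℝ) (hm : ∀ b, 0 ≤ m b)
    {a : ℝ} (ha0 : 0 ≤ a) (ha : ∀ b, m b * ((Finset.univ.filter fun j => blk j = b).card : ℝ) ≤ a) (φ : ι → ℝ) {Θ : ℝ}
    (hΘ0 : 0 ≤ Θ) (hΘ : ∀ j k, blk j = blk k → |φ j - φ k| ≤ Θ) (z u : ι → ℝ) :
    |∑ j, ∑ k, (Real.exp (φ j - φ k) - 1) * (if blk k = blk j then m (blk j) else 0) * (z j * u k)| ≤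
      a * (Real.exp Θ - 1) * (Real.sqrt (z ⬝ᵥ z) * Real.sqrt (u ⬝ᵥ u)) := by
  classical
  have hε0 : 0 ≤ Real.exp Θ - 1 := by linarith [Real.add_one_le_exp Θ]
  set B : ι → ι → ℝ := fun j k => if blk k = blk j then m (blk j) else 0 with hB
  have hB0 : ∀ j k, 0 ≤ B j k := fun j k => by simp only [hB]; split_ifs <;> [exact hm _; exact le_rfl]
  -- termwise: `|E·B·z·u| ≤ (e^Θ−1)·B·|z|·|u|`
  have hterm : ∀ j k, |(Real.exp (φ j - φ k) - 1) * B j k * (z j * u k)| ≤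
      (Real.exp Θ - 1) * (Real.sqrt (B j k) * |z j| * (Real.sqrt (B j k) * |u k|)) := by
    intro j k
    have hBB : Real.sqrt (B j k) * |z j| * (Real.sqrt (B j k) * |u k|) = B j k * (|z j| * |u k|) := by
      have := Real.mul_self_sqrt (hB0 j k)
      calc Real.sqrt (B j k) * |z j| * (Real.sqrt (B j k) * |u k|) = (Real.sqrt (B j k) * Real.sqrt (B j k)) * (|z j| * |u k|) := by
            ring
        _ = B j k * (|z j| * |u k|) := by rw [this]
    rw [hBB, abs_mul, abs_mul, abs_mul, abs_of_nonneg (hB0 j k)]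
    by_cases hjk : blk k = blk j
    · have hE : |Real.exp (φ j - φ k) - 1| ≤ Real.exp Θ - 1 := abs_exp_sub_one_le (hΘ j k hjk.symm)
      calc |Real.exp (φ j - φ k) - 1| * B j k * (|z j| * |u k|) ≤ (Real.exp Θ - 1) * B j k * (|z j| * |u k|) :=
            mul_le_mul_of_nonneg_right (mul_le_mul_of_nonneg_right hE (hB0 j k))
              (mul_nonneg (abs_nonneg _) (abs_nonneg _))
        _ = (Real.exp Θ - 1) * (B j k * (|z j| * |u k|)) := by ring
    · have hB00 : B j k = 0 := by simp only [hB, hjk, if_false]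
      rw [hB00]; simp
  -- row and column masses of `B`
  have hrow : ∀ j, ∑ k, B j k ≤ a := by
    intro j
    have : ∑ k, B j k = m (blk j) * ((Finset.univ.filter fun k => blk k = blk j).card : ℝ) := by
      simp only [hB]
      rw [← Finset.sum_filter, Finset.sum_const, nsmul_eq_mul, mul_comm]
    rw [this]; exact ha (blk j)
  have hcol : ∀ k, ∑ j, B j k ≤ a := by
    intro k
    have : ∑ j, B j k = m (blk k) * ((Finset.univ.filter fun j => blk j = blk k).card : ℝ) := by
      have h1 : ∀ j, B j k = if blk j = blk k then m (blk k) else 0 := by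
        intro j; simp only [hB]
        by_cases h : blk k = blk j
        · rw [if_pos h, if_pos h.symm, h]
        · rw [if_neg h, if_neg (fun h' => h h'.symm)]
      simp_rw [h1]
      rw [← Finset.sum_filter, Finset.sum_const, nsmul_eq_mul, mul_comm]
    rw [this]; exact ha (blk k)
  -- Cauchy–Schwarz
  have hcs := abs_double_le_sqrt (fun j k => Real.sqrt (B j k) * |z j|) (fun j k => Real.sqrt (B j k) * |u k|)
  have hZ : ∑ j, ∑ k, (Real.sqrt (B j k) * |z j|) ^ 2 ≤ a * (z ⬝ᵥ z) := by
    have : ∑ j, ∑ k, (Real.sqrt (B j k) * |z j|) ^ 2 = ∑ j, (∑ k, B j k) * (z j * z j) := by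
      refine Finset.sum_congr rfl fun j _ => ?_
      rw [Finset.sum_mul]
      exact Finset.sum_congr rfl fun k _ => by rw [mul_pow, Real.sq_sqrt (hB0 j k), sq_abs, sq]
    rw [this, dotProduct, Finset.mul_sum]
    exact Finset.sum_le_sum fun j _ => mul_le_mul_of_nonneg_right (hrow j) (mul_self_nonneg _)
  have hU : ∑ j, ∑ k, (Real.sqrt (B j k) * |u k|) ^ 2 ≤ a * (u ⬝ᵥ u) := by
    have : ∑ j, ∑ k, (Real.sqrt (B j k) * |u k|) ^ 2 = ∑ k, (∑ j, B j k) * (u k * u k) := by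
      rw [Finset.sum_comm]
      refine Finset.sum_congr rfl fun k _ => ?_
      rw [Finset.sum_mul]
      exact Finset.sum_congr rfl fun j _ => by rw [mul_pow, Real.sq_sqrt (hB0 j k), sq_abs, sq]
    rw [this, dotProduct, Finset.mul_sum]
    exact Finset.sum_le_sum fun k _ => mul_le_mul_of_nonneg_right (hcol k) (mul_self_nonneg _)
  have habs : |∑ j, ∑ k, (Real.exp (φ j - φ k) - 1) * B j k * (z j * u k)| ≤
      (Real.exp Θ - 1) * ∑ j, ∑ k, Real.sqrt (B j k) * |z j| * (Real.sqrt (B j k) * |u k|) := by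
    refine (Finset.abs_sum_le_sum_abs _ _).trans ?_
    rw [Finset.mul_sum]
    refine Finset.sum_le_sum fun j _ => (Finset.abs_sum_le_sum_abs _ _).trans ?_
    rw [Finset.mul_sum]
    exact Finset.sum_le_sum fun k _ => hterm j k
  have hpos : 0 ≤ ∑ j, ∑ k, Real.sqrt (B j k) * |z j| * (Real.sqrt (B j k) * |u k|) :=
    Finset.sum_nonneg fun _ _ => Finset.sum_nonneg fun _ _ => by positivity
  calc |∑ j, ∑ k, (Real.exp (φ j - φ k) - 1) * B j k * (z j * u k)|
      ≤ (Real.exp Θ - 1) * ∑ j, ∑ k, Real.sqrt (B j k) * |z j| * (Real.sqrt (B j k) * |u k|) := habs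
    _ ≤ (Real.exp Θ - 1) * (Real.sqrt (a * (z ⬝ᵥ z)) * Real.sqrt (a * (u ⬝ᵥ u))) := by
        refine mul_le_mul_of_nonneg_left ((le_abs_self _).trans (hcs.trans ?_)) hε0
        exact mul_le_mul (Real.sqrt_le_sqrt hZ) (Real.sqrt_le_sqrt hU) (Real.sqrt_nonneg _) (Real.sqrt_nonneg _)
    _ = a * (Real.exp Θ - 1) * (Real.sqrt (z ⬝ᵥ z) * Real.sqrt (u ⬝ᵥ u)) := by
        rw [Real.sqrt_mul ha0, Real.sqrt_mul ha0,
          show Real.sqrt a * Real.sqrt (z ⬝ᵥ z) * (Real.sqrt a * Real.sqrt (u ⬝ᵥ u)) =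
            (Real.sqrt a * Real.sqrt a) * (Real.sqrt (z ⬝ᵥ z) * Real.sqrt (u ⬝ᵥ u)) by ring, Real.mul_self_sqrt ha0]
        ring

end Abstract

end Summit.QuantumFields.BalabanUV.T4Continuum.NE7K1LinBilinConjError
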